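import Summits.BirchSwinnertonDyer.Rank1Residual.X12.O11.RamifiedRelativeValuationLineZp
import HarnessLib

set_option linter.dupNamespace false
set_option autoImplicit false

/-!
# Route `RamifiedSevenEllipticUnits` (rung K7r), value crux `EllipticUnitValueSevenOfGZK`
# (stmt-BirchSwinnertonDyer-19945), line `rubin-formula-zp` SKELETON v3 — ANATOMY of the archimedean stub
# `S_arch`: what its clause `r ≠ 0` packages (`--supports 19945 --as helper`; line owner `bsd-cm-k7r-c4` g7)

HONEST FRAMING: kernel bookkeeping on the typed Props of `X12/O11/RamifiedRelativeValuationLineZp.lean`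
(p487655); nothing about any curve is asserted; BSD is not proved; no definition, no named fact, `sorry`-free.
The planner (STATUS 2026-08-27T02:21:51Z) asked that the carrier identity of the v3 stubs be stated in ONE
currency on both sides — `(heckePowerCentralValue φ (p^m) / heckePowerCentralValue φ₀ (p^m))² = r` — so that
the clause `r ≠ 0` HONESTLY carries the non-vanishing of BOTH central values: Lean's `x / 0 = 0` makes a
vanishing base value produce `r = 0`. This file records that reading in the kernel:

* `ne_zero_and_ne_zero_of_div_sq_eq` — `(a / b)² = r ≠ 0 ⇒ a ≠ 0 ∧ b ≠ 0` (in `ℂ`, `r : ℚ`).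
* `RelativeValuationAnatomy.centralValues_ne_zero_of_archimedean` — `S_arch W p D₀` implies, at every
  analytic-rank-one frame with its Mordell–Weil data and every `φ` pinned to `W`, the existence of a base
  model `W₀`, a pinned `φ₀` and an exponent `m` with `L(φ^{2·p^m+1}, p^m+1) ≠ 0` AND `L(φ₀^{2·p^m+1}, p^m+1) ≠ 0`
  (central values read through `heckePowerCentralValue`): the archimedean residue CONTAINS the unit base's
  non-vanishing at the weight used (ram g9 memo §1 (v) / (P2)) and the member's own non-vanishing at some
  weight `2·p^m + 2` in the `p`-power family (sign `+1` there — referee g41's gap (ii) is thus inside the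
  stub, not beside it).
* `RelativeValuationAnatomy.relativeValuation_threshold_mono` — the threshold clause of `S_relval` is
  monotone in `m` only through `r`: a purely propositional remark recorded for the tribunal's vacuity
  battery (if `padicValRat p r < 1 + 2m` then also `< 1 + 2m'` for `m ≤ m'`).

References: cell memo RELATIVE-RUBIN-ram-g9.md §1 (v), §4.1 (P2); STATUS D123/D127; referee
REFEREE-COUNTERSIGN-RELRUBIN-G41.md (gap (ii)). [BKNO] arXiv:2608.06879 Thm. 4.12 [BurungaleKobayashiNakamuraOta2026].
-/

noncomputable section

open scoped Classical

open WeierstrassCurve NumberField IsDedekindDomain Field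
  Literature.NumberTheory.EllipticCurves
  Literature.NumberTheory.EllipticCurves.Rank1Residual
  Literature.NumberTheory.EllipticCurves.BurungaleKobayashiNakamuraOta2026
  Literature.NumberTheory.GaloisRepresentations
  Literature.NumberTheory.DiophantineGeometry
  Summit.BirchSwinnertonDyer.Rank1Residual
  Summit.BirchSwinnertonDyer.Rank1Residual.X12
  Summit.BirchSwinnertonDyer.Rank1Residual.X12.O11

namespace Summit.BirchSwinnertonDyer.BirchSwinnertonDyer.Theorems.RamifiedSevenEllipticUnits

namespace RelativeValuationAnatomy

/-- `(a / b)² = r` with `r ≠ 0` (a rational read in `ℂ`) forces `a ≠ 0` and `b ≠ 0` — because `a / 0 = 0` and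
`0 / b = 0` in Lean. This is why the v3 stubs' clause `r ≠ 0` carries the non-vanishing of both central values.
[folklore] -/
theorem ne_zero_and_ne_zero_of_div_sq_eq {a b : ℂ} {r : ℚ} (h : (a / b) ^ 2 = (r : ℂ)) (hr : r ≠ 0) :
    a ≠ 0 ∧ b ≠ 0 := by
  have hab : a / b ≠ 0 := by
    intro h0
    rw [h0, zero_pow two_ne_zero] at h
    exact hr (by exact_mod_cast h.symm)
  exact ⟨fun ha => hab (by rw [ha, zero_div]), fun hb => hab (by rw [hb, div_zero])⟩

variable {W : WeierstrassCurve ℚ} [W.IsElliptic] [W.IsGloballyMinimal] {p : ℕ} [Fact p.Prime] {D₀ : ℤ}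

omit [W.IsGloballyMinimal] in
/-- **What `S_arch` packages (non-vanishing).** `RamifiedCMArchimedeanValuationAtZp W p D₀` gives, at every
analytic-rank-one O11 frame with its Mordell–Weil data, `#Ш_an`'s and every Hecke character `φ` pinned to `W`,
a globally minimal base model `W₀` of `49a1^{(D₀)}`, a `φ₀` pinned to `W₀` and an exponent `m` such that BOTH
central values `heckePowerCentralValue φ (p^m)` and `heckePowerCentralValue φ₀ (p^m)` are non-zero — the unit
base's non-vanishing at the weight used (memo §1 (v)/(P2)) and the member's own non-vanishing at some weight
`2·p^m + 2` (so the sign there is `+1`: referee g41's gap (ii) lives inside the stub). Pure unpacking of the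
typed Prop. [cite: BurungaleKobayashiNakamuraOta2026, Thm. 4.12 (arXiv:2608.06879 p. 32) (the interpolated values; claim; preprint; shape only)] -/
theorem centralValues_ne_zero_of_archimedean (harch : RamifiedCMArchimedeanValuationAtZp W p D₀)
    (K : Type) [Field K] [NumberField K] (𝔭 : HeightOneSpectrum (𝓞 K))
    (W' : WeierstrassCurve ℚ) [W'.IsElliptic] [W'.IsGloballyMinimal] (C : VariableChange ℚ)
    (hF : IsFrame W p K 𝔭 W' C) (hr : W.analyticRank = 1)
    (P : W.toAffine.Point) (n : ℕ) (P' : W'.toAffine.Point) (n' : ℕ)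
    (hP : ¬ IsOfFinAddOrder P)
    (hgen : ∀ R : W.toAffine.Point, ∃ (k : ℤ) (T : W.toAffine.Point), IsOfFinAddOrder T ∧ R = k • P + T)
    (htors : ∀ Q : (W.baseChange ℚ_[p]).toAffine.Point, p • Q = 0 → Q = 0)
    (hdiv : ∃ Q : (W.baseChange ℚ_[p]).toAffine.Point, p ^ n • Q = W.toPadicPoint p P)
    (hndiv : ∀ Q : (W.baseChange ℚ_[p]).toAffine.Point, p ^ (n + 1) • Q ≠ W.toPadicPoint p P)
    (hP' : ¬ IsOfFinAddOrder P')
    (hgen' : ∀ R : W'.toAffine.Point, ∃ (k : ℤ) (T : W'.toAffine.Point),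
      IsOfFinAddOrder T ∧ R = k • P' + T)
    (htors' : ∀ Q : (W'.baseChange ℚ_[p]).toAffine.Point, p • Q = 0 → Q = 0)
    (hdiv' : ∃ Q : (W'.baseChange ℚ_[p]).toAffine.Point, p ^ n' • Q = W'.toPadicPoint p P')
    (hndiv' : ∀ Q : (W'.baseChange ℚ_[p]).toAffine.Point, p ^ (n' + 1) • Q ≠ W'.toPadicPoint p P')
    (q q' : ℚ) (hq : shaAn W = (q : ℂ)) (hq' : shaAn W' = (q' : ℂ))
    (φ : HeckeCharacter K) (hφ : ∀ s : ℂ, 3 / 2 < s.re → heckeLFunction φ s = W.LSeries s) :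
    ∃ (W₀ : WeierstrassCurve ℚ) (_ : W₀.IsElliptic) (_ : W₀.IsGloballyMinimal)
      (_ : ∃ C₀ : VariableChange ℚ, C₀ • W₀ = cm7.quadraticTwist (D₀ : ℚ))
      (φ₀ : HeckeCharacter K) (_ : ∀ s : ℂ, 3 / 2 < s.re → heckeLFunction φ₀ s = W₀.LSeries s) (m : ℕ),
      heckePowerCentralValue φ (p ^ m) ≠ 0 ∧ heckePowerCentralValue φ₀ (p ^ m) ≠ 0 := by
  obtain ⟨W₀, hE, hM, hW₀, φ₀, hφ₀, m, r, -, -, hρ, hr0, -, -⟩ :=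
    harch K 𝔭 W' C hF hr P n P' n' hP hgen htors hdiv hndiv hP' hgen' htors' hdiv' hndiv' q q' hq hq' φ hφ
  exact ⟨W₀, hE, hM, hW₀, φ₀, hφ₀, m, ne_zero_and_ne_zero_of_div_sq_eq hρ hr0⟩

omit [Fact (Nat.Prime p)] in
/-- The threshold clause of `S_relval`/`S_arch` is monotone in the exponent: `padicValRat p r < 1 + 2m` implies
`padicValRat p r < 1 + 2m'` for `m ≤ m'` (so a certificate at some `m` serves every larger `m` with the SAME `r`
only in this propositional sense — the central values themselves change with `m`). [folklore] -/
theorem relativeValuation_threshold_mono {r : ℚ} {m m' : ℕ} (h : padicValRat p r < 1 + 2 * (m : ℤ))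
    (hmm' : m ≤ m') : padicValRat p r < 1 + 2 * (m' : ℤ) := by
  have : (m : ℤ) ≤ m' := by exact_mod_cast hmm'
  linarith

end RelativeValuationAnatomy

end Summit.BirchSwinnertonDyer.BirchSwinnertonDyer.Theorems.RamifiedSevenEllipticUnits

end
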